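import Literature.NumberTheory.Sieve.PrimeGapLimitPoints
import Literature.NumberTheory.Sieve.ParityWave0SmallGapsProofs
import HarnessLib

/-!
# `0 ∈ 𝓛`: zero is a limit point of the normalized prime gaps, unconditionally

Topic `Literature/NumberTheory/Sieve`; a leaf over `PrimeGapLimitPoints.lean` (the set
`𝓛 = primeGapLimitSet` of finite limit points of `(p_{n+1} − p_n)/log p_n`) and
`ParityWave0SmallGapsProofs.lean` (the DISCHARGED named fact
`Literature.NumberTheory.Sieve.frequently_nth_prime_gap_lt_mul_log`, Goldston–Pintz–Yıldırım,
*Primes in tuples I*, Ann. of Math. 170 (2009), Theorem 2, display (1.8):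
`liminf_{n→∞} (p_{n+1} − p_n)/log p_n = 0`, proved in the tree along Maynard's bounded-gaps theorem).

Merikoski, *Limit points of normalized prime gaps*, J. London Math. Soc. 102 (2020), §1: "from the
seminal work of Goldston, Pintz and Yıldırım [GPY] it follows that `0 ∈ 𝓛`." This file records exactly
that deduction as kernel theorems, with no hypothesis:

* `normalizedPrimeGap_nonneg`, `normalizedPrimeGap_lt_iff` — bookkeeping (`p_{n+1} > p_n`, `log p_n > 0`);
* `zero_mem_primeGapLimitSet_of_frequently` — the one-line topology: if for every `ε > 0` the
  normalized gap is `< ε` infinitely often, then `0` is a cluster point of the sequence;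
* `zero_mem_primeGapLimitSet : (0 : ℝ) ∈ primeGapLimitSet` — **unconditional** (GPY Theorem 2 via
  `frequently_nth_prime_gap_lt_mul_log_holds`);
* `liminf_normalizedPrimeGap_eq_zero : liminf normalizedPrimeGap atTop = 0` — display (1.8) itself,
  `E₁ = 0`, in Mathlib's `Filter.liminf` currency (the set of eventual lower bounds is exactly `(−∞, 0]`).

Requested by the Parity ideation cell (parity-ideate-p4, family E «gap-set»: the closed set `𝓛`
contains `0`; with `Gallagher.Ici_subset_primeGapLimitSet_of_GHL` the conditional picture is
`GHL ⇒ [0, ∞) ⊆ 𝓛`, and this file is the unconditional endpoint). No new definitions, no named facts.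

## References

* D. A. Goldston, J. Pintz, C. Y. Yıldırım, *Primes in tuples. I*, Ann. of Math. (2) 170 (2009)
  819–862, Theorem 2, (1.8). [cite: GoldstonPintzYildirim2009, Theorem 2]
* J. Merikoski, *Limit points of normalized prime gaps*, J. Lond. Math. Soc. (2) 102 (2020) 99–124,
  §1 (p. 2 of arXiv:1811.03008: "`0 ∈ 𝓛`" by [GPY]; "`∞ ∈ 𝓛`" by Westzynthius, not a real number and not
  recorded). [cite: Merikoski2020GapLimitPoints, §1]
-/

open Filter Set Topology

namespace Literature.NumberTheory.Sieve

/-- `p_n < p_{n+1}` for Mathlib's `Nat.nth Nat.Prime`. [folklore] -/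
private theorem nth_prime_lt_nth_prime_succ (n : ℕ) : Nat.nth Nat.Prime n < Nat.nth Nat.Prime (n + 1) :=
  Nat.nth_strictMono Nat.infinite_setOf_prime (Nat.lt_succ_self n)

/-- `log p_n > 0` (`p_n ≥ 2`). [folklore] -/
private theorem log_nth_prime_pos (n : ℕ) : 0 < Real.log (Nat.nth Nat.Prime n : ℝ) :=
  Real.log_pos (by exact_mod_cast (Nat.prime_nth_prime n).one_lt)

/-- Normalized prime gaps are non-negative: `(p_{n+1} − p_n)/log p_n ≥ 0`.
[cite: Merikoski2020GapLimitPoints, §1] -/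
theorem normalizedPrimeGap_nonneg (n : ℕ) : 0 ≤ normalizedPrimeGap n := by
  unfold normalizedPrimeGap
  refine div_nonneg ?_ (log_nth_prime_pos n).le
  rw [sub_nonneg]
  exact_mod_cast (nth_prime_lt_nth_prime_succ n).le

/-- `(p_{n+1} − p_n)/log p_n < ε ↔ p_{n+1} − p_n < ε log p_n` — the passage between the normalized-gap
currency of `𝓛` and the currency of the named fact `frequently_nth_prime_gap_lt_mul_log`.
[cite: GoldstonPintzYildirim2009, Theorem 2] -/
theorem normalizedPrimeGap_lt_iff (n : ℕ) (ε : ℝ) :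
    normalizedPrimeGap n < ε ↔
      (Nat.nth Nat.Prime (n + 1) : ℝ) - Nat.nth Nat.Prime n < ε * Real.log (Nat.nth Nat.Prime n) := by
  unfold normalizedPrimeGap
  rw [div_lt_iff₀ (log_nth_prime_pos n)]

/-- The topology step: if for every `ε > 0` one has `p_{n+1} − p_n < ε log p_n` for infinitely many
`n` (GPY Theorem 2 in the `∃ᶠ` form of the tree's named fact), then `0` is a limit point of the
normalized prime gaps, `0 ∈ 𝓛`. [cite: Merikoski2020GapLimitPoints, §1] -/
theorem zero_mem_primeGapLimitSet_of_frequently (h : frequently_nth_prime_gap_lt_mul_log) :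
    (0 : ℝ) ∈ primeGapLimitSet := by
  rw [mem_primeGapLimitSet, mapClusterPt_iff_frequently]
  intro U hU
  obtain ⟨ε, hε, hball⟩ := Metric.mem_nhds_iff.1 hU
  refine (h ε hε).mono fun n hn => hball ?_
  rw [Metric.mem_ball, Real.dist_eq, sub_zero, abs_of_nonneg (normalizedPrimeGap_nonneg n)]
  exact (normalizedPrimeGap_lt_iff n ε).2 hn

/-- **`0 ∈ 𝓛`, unconditionally** — "from the seminal work of Goldston, Pintz and Yıldırım [GPY] it
follows that `0 ∈ 𝓛`": zero is a limit point of the sequence `(p_{n+1} − p_n)/log p_n`. Kernel proof: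
the tree's discharge `frequently_nth_prime_gap_lt_mul_log_holds` of GPY Theorem 2 (along Maynard's
bounded gaps) and `zero_mem_primeGapLimitSet_of_frequently`.
[cite: Merikoski2020GapLimitPoints, §1] [cite: GoldstonPintzYildirim2009, Theorem 2] -/
theorem zero_mem_primeGapLimitSet : (0 : ℝ) ∈ primeGapLimitSet :=
  zero_mem_primeGapLimitSet_of_frequently frequently_nth_prime_gap_lt_mul_log_holds

/-- The set of eventual lower bounds of the normalized prime gaps is exactly `(−∞, 0]`: every `a ≤ 0`
is one (the gaps are `≥ 0`), and no `a > 0` is one (GPY: the gap is `< a` infinitely often).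
[cite: GoldstonPintzYildirim2009, Theorem 2] -/
theorem setOf_eventually_le_normalizedPrimeGap :
    {a : ℝ | ∀ᶠ n in atTop, a ≤ normalizedPrimeGap n} = Set.Iic 0 := by
  ext a
  simp only [Set.mem_setOf_eq, Set.mem_Iic]
  constructor
  · intro ha
    rcases le_or_gt a 0 with hle | hpos
    · exact hle
    have hfreq : ∃ᶠ n in atTop, normalizedPrimeGap n < a :=
      (frequently_nth_prime_gap_lt_mul_log_holds a hpos).mono
        fun n hn => (normalizedPrimeGap_lt_iff n a).2 hn
    exact (hfreq (ha.mono fun n hn => not_lt.2 hn)).elim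
  · intro ha
    exact Eventually.of_forall fun n => ha.trans (normalizedPrimeGap_nonneg n)

/-- **GPY Theorem 2, display (1.8), in `Filter.liminf` currency:**
`E₁ = liminf_{n → ∞} (p_{n+1} − p_n)/log p_n = 0`, unconditionally.
[cite: GoldstonPintzYildirim2009, Theorem 2] -/
theorem liminf_normalizedPrimeGap_eq_zero : liminf normalizedPrimeGap atTop = 0 := by
  rw [Filter.liminf_eq, setOf_eventually_le_normalizedPrimeGap, csSup_Iic]

end Literature.NumberTheory.Sieve
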